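import Mathlib
import Summits.AnomalousDissipation.AnomalousDissipation.Theorems.MarginalStabilityChainBurgersLayerKHStubSheetLimitA

/-!
# Toolkit for the vortex-sheet limit (stub `stub_sheetLimit`, line `Sketch`), part B

Crux `MarginalStabilityChain.BurgersLayerKH` (stmt-AnomalousDissipation-3008), line `Sketch`: helper file for the
registered stub `stub_sheetLimit` (the vortex-sheet / long-wave limit of the Rayleigh sheet coefficient;
route and assembly in `…StubSheetLimit.lean`: an exact Wronskian identity for the sheet coefficient plus
a zeroth-order Jost comparison `‖m - m₀‖ = O(α)` from the weighted Volterra theory).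

This file (part B): from the ODE `m'' = 2αm' + F` with data at `+∞` to the Volterra form
`m = c + K_α F` (the primitive `k_α(t-y)m'(t) - m(t)`); the zeroth-order Jost function
`m₀ = (λ+iU)/(λ+iU₊)` (`m₀ = 1 + K₀[Vm₀]`, `∫U'm₀ = 2λU₊/(λ+iU₊)`); and the conjugation `m = e^{αy}ψ`
of a slow mode (`m'' = 2αm' + Vm`, `e^{αy}ω = -Vm`).
-/

set_option linter.dupNamespace false

noncomputable section

open Complex MeasureTheory Filter Topology Set Metric

namespace Summit.AnomalousDissipation.AnomalousDissipation.Theorems.BurgersLayerKH.Sheet.SheetLimit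

/-! ## A7. From the ODE `m'' = 2α m' + F` (data at `+∞`) to the Volterra form `m = c + K_α F` -/

/-- If `m'' = 2α m' + F` on `ℝ` with `m → c`, `m' → 0`, `t m'(t) → 0` at `+∞` and `(1+|t|)F`
integrable, then `m(y) = c + ∫_{t>y} k_α(t-y) F(t) dt` (the primitive
`t ↦ k_α(t-y) m'(t) - m(t)` of the integrand is evaluated between `y` and `+∞`). [folklore] -/
theorem volterra_of_ode {α : ℝ} (hα : 0 ≤ α) {F m m' : ℝ → ℂ} {c : ℂ}
    (hm : ∀ t, HasDerivAt m (m' t) t) (hm' : ∀ t, HasDerivAt m' (2 * α * m' t + F t) t)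
    (hF : Continuous F) (hFi : Integrable fun t => (1 + |t|) * ‖F t‖)
    (hlim : Tendsto m atTop (𝓝 c)) (hlim0 : Tendsto m' atTop (𝓝 0))
    (hlim1 : Tendsto (fun t : ℝ => (t : ℂ) * m' t) atTop (𝓝 0)) (y : ℝ) :
    m y = c + ∫ t in Ioi y, (volterraKernel α (t - y) : ℂ) * F t := by
  set Φ : ℝ → ℂ := fun t => (volterraKernel α (t - y) : ℂ) * m' t - m t with hΦ
  have hk : ∀ t, HasDerivAt (fun t => volterraKernel α (t - y)) (Real.exp (-(2 * α * (t - y)))) t := by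
    intro t
    exact HasDerivAt.comp_sub_const t y (hasDerivAt_volterraKernel α (t - y))
  have hΦd : ∀ t, HasDerivAt Φ ((volterraKernel α (t - y) : ℂ) * F t) t := by
    intro t
    have h2 := (((hk t).ofReal_comp).mul (hm' t)).sub (hm t)
    refine h2.congr_deriv ?_
    have hc : (((2 * α * volterraKernel α (t - y) : ℝ)) : ℂ) =
        (((1 - Real.exp (-(2 * α * (t - y)))) : ℝ) : ℂ) := by rw [two_mul_volterraKernel]
    simp only [Complex.ofReal_mul, Complex.ofReal_sub, Complex.ofReal_one, Complex.ofReal_ofNat] at hc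
    linear_combination (m' t) * hc
  have hΦ_tend : Tendsto Φ atTop (𝓝 (0 - c)) := by
    refine Tendsto.sub ?_ hlim
    have hb : Tendsto (fun t : ℝ => ‖(t : ℂ) * m' t‖ + |y| * ‖m' t‖) atTop (𝓝 0) := by
      have := (tendsto_norm_zero.comp hlim1).add ((tendsto_norm_zero.comp hlim0).const_mul |y|)
      simpa using this
    refine squeeze_zero_norm' ?_ hb
    filter_upwards [eventually_ge_atTop y] with t ht
    have hkb := volterraKernel_bounds hα (sub_nonneg.2 ht)
    rw [norm_mul, Complex.norm_real, Real.norm_of_nonneg hkb.1]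
    have hn := norm_nonneg (m' t)
    calc volterraKernel α (t - y) * ‖m' t‖ ≤ (t - y) * ‖m' t‖ := by gcongr; exact hkb.2.1
      _ ≤ |t| * ‖m' t‖ + |y| * ‖m' t‖ := by nlinarith [le_abs_self t, neg_abs_le y]
      _ = ‖(t : ℂ) * m' t‖ + |y| * ‖m' t‖ := by rw [norm_mul, Complex.norm_real, Real.norm_eq_abs]
  have hΦ'i : IntegrableOn (fun t => (volterraKernel α (t - y) : ℂ) * F t) (Ioi y) := by
    have hmaj : Integrable fun t => (1 + |y|) * ((1 + |t|) * ‖F t‖) := hFi.const_mul _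
    refine Integrable.mono' (hmaj.integrableOn (s := Ioi y)).integrable ?_ ?_
    · have : Continuous fun t => (volterraKernel α (t - y) : ℂ) * F t :=
        (continuous_ofReal.comp ((Volterra.continuous_volterraKernel α).comp (continuous_id.sub continuous_const))).mul hF
      exact this.aestronglyMeasurable
    · refine (ae_restrict_iff' measurableSet_Ioi).2 (Eventually.of_forall fun t ht => ?_)
      have hkb := volterraKernel_bounds hα (sub_nonneg.2 (le_of_lt ht))
      rw [norm_mul, Complex.norm_real, Real.norm_of_nonneg hkb.1]
      have hn := norm_nonneg (F t)
      calc volterraKernel α (t - y) * ‖F t‖ ≤ (t - y) * ‖F t‖ := by gcongr; exact hkb.2.1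
        _ ≤ (1 + |y|) * ((1 + |t|) * ‖F t‖) := by
            nlinarith [le_abs_self t, neg_abs_le y, abs_nonneg t, abs_nonneg y, mul_nonneg (abs_nonneg t) (abs_nonneg y)]
  have hmain := integral_Ioi_of_hasDerivAt_of_tendsto' (fun t _ => hΦd t) hΦ'i hΦ_tend
  have hΦy : Φ y = -m y := by simp [hΦ, Volterra.volterraKernel_zero]
  rw [hmain, hΦy]; ring

/-! ## A8. The zeroth-order Jost function `m₀ = (λ + iU)/(λ + iU₊)` -/

/-- `m₀' = iU'/(λ + iU₊)`. [folklore] -/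
theorem hasDerivAt_m0 (lam : ℂ) (t : ℝ) :
    HasDerivAt (fun t : ℝ => (lam + I * (U t : ℂ)) / (lam + I * Uinf))
      (I * (Real.exp (-(t ^ 2) / 2) : ℂ) / (lam + I * Uinf)) t :=
  (((Strained.hasDerivAt_U t).ofReal_comp.const_mul I).const_add lam).div_const _

/-- `m₀'' = iU''/(λ + iU₊)`. [folklore] -/
theorem hasDerivAt_m0' (lam : ℂ) (t : ℝ) :
    HasDerivAt (fun t : ℝ => I * (Real.exp (-(t ^ 2) / 2) : ℂ) / (lam + I * Uinf))
      (I * (Upp t : ℂ) / (lam + I * Uinf)) t :=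
  ((hasDerivAt_gauss_half t).ofReal_comp.const_mul I).div_const _

/-- `m₀ → 1` at `+∞`. [folklore] -/
theorem tendsto_m0_atTop {lam : ℂ} (hlam : 0 < lam.re) :
    Tendsto (fun t : ℝ => (lam + I * (U t : ℂ)) / (lam + I * Uinf)) atTop (𝓝 1) := by
  have hD : lam + I * Uinf ≠ 0 := add_I_mul_ne_zero hlam Uinf
  have h1 : Tendsto (fun t : ℝ => lam + I * (U t : ℂ)) atTop (𝓝 (lam + I * Uinf)) :=
    tendsto_const_nhds.add (((continuous_ofReal.tendsto _).comp tendsto_U_atTop).const_mul I)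
  simpa [div_self hD] using h1.div_const (lam + I * Uinf)

/-- `m₀ → (λ - iU₊)/(λ + iU₊)` at `-∞`. [folklore] -/
theorem tendsto_m0_atBot (lam : ℂ) :
    Tendsto (fun t : ℝ => (lam + I * (U t : ℂ)) / (lam + I * Uinf)) atBot
      (𝓝 ((lam - I * Uinf) / (lam + I * Uinf))) := by
  have h1 : Tendsto (fun t : ℝ => lam + I * (U t : ℂ)) atBot (𝓝 (lam + I * ((-Uinf : ℝ) : ℂ))) :=
    tendsto_const_nhds.add (((continuous_ofReal.tendsto _).comp tendsto_U_atBot).const_mul I)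
  have := h1.div_const (lam + I * Uinf)
  simpa [sub_eq_add_neg] using this

/-- `‖m₀ t‖ ≤ (‖λ‖ + |t|)/re λ`. [folklore] -/
theorem norm_m0_le {lam : ℂ} (hlam : 0 < lam.re) (t : ℝ) :
    ‖(lam + I * (U t : ℂ)) / (lam + I * Uinf)‖ ≤ (‖lam‖ + 1) / lam.re * (1 + |t|) := by
  rw [norm_div, div_le_iff₀ (lt_of_lt_of_le hlam (re_le_norm_add_I_mul lam Uinf))]
  calc ‖lam + I * (U t : ℂ)‖ ≤ ‖lam‖ + ‖I * (U t : ℂ)‖ := norm_add_le _ _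
    _ = ‖lam‖ + |U t| := by rw [norm_mul, Complex.norm_I, one_mul, Complex.norm_real, Real.norm_eq_abs]
    _ ≤ ‖lam‖ + |t| := by linarith [Strained.abs_U_le t]
    _ ≤ (‖lam‖ + 1) * (1 + |t|) := by nlinarith [norm_nonneg lam, abs_nonneg t]
    _ = (‖lam‖ + 1) / lam.re * (1 + |t|) * lam.re := by field_simp
    _ ≤ (‖lam‖ + 1) / lam.re * (1 + |t|) * ‖lam + I * (Uinf : ℂ)‖ := by
        gcongr; exact re_le_norm_add_I_mul lam Uinf

/-- The Volterra form of `m₀`: `m₀ = 1 + K₀[V m₀]`. [folklore] -/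
theorem m0_volterra {lam : ℂ} (hlam : 0 < lam.re) (y : ℝ) :
    (lam + I * (U y : ℂ)) / (lam + I * Uinf) = 1 + ∫ t in Ioi y, (volterraKernel 0 (t - y) : ℂ) *
      (I * (Upp t : ℂ) / (lam + I * (U t : ℂ))) * ((lam + I * (U t : ℂ)) / (lam + I * Uinf)) := by
  have hD : lam + I * Uinf ≠ 0 := add_I_mul_ne_zero hlam Uinf
  have hDpos : 0 < ‖lam + I * Uinf‖ := norm_pos_iff.2 hD
  set F : ℝ → ℂ := fun t => (I * (Upp t : ℂ) / (lam + I * (U t : ℂ))) * ((lam + I * (U t : ℂ)) / (lam + I * Uinf)) with hF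
  have hFeq : ∀ t, F t = I * (Upp t : ℂ) / (lam + I * Uinf) := by
    intro t; simp only [hF]; field_simp [add_I_mul_ne_zero hlam (U t)]
  have hFn : ∀ t, ‖F t‖ ≤ 1 / ‖lam + I * Uinf‖ * ((1 + |t|) ^ 0 * Real.exp (0 * t) * Real.exp (-(t ^ 2) / 4)) := by
    intro t
    rw [hFeq, norm_div, norm_mul, Complex.norm_I, one_mul, Complex.norm_real, Real.norm_eq_abs]
    simp only [pow_zero, zero_mul, Real.exp_zero, one_mul, mul_one]
    calc |Upp t| / ‖lam + I * Uinf‖ ≤ Real.exp (-(t ^ 2) / 4) / ‖lam + I * Uinf‖ := by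
          gcongr; exact abs_Upp_le t
      _ = _ := by ring
  have key := volterra_of_ode (α := 0) le_rfl (F := F) (c := 1)
    (m := fun t : ℝ => (lam + I * (U t : ℂ)) / (lam + I * Uinf))
    (m' := fun t : ℝ => I * (Real.exp (-(t ^ 2) / 2) : ℂ) / (lam + I * Uinf))
    (hasDerivAt_m0 lam) (fun t => by simpa [hFeq] using hasDerivAt_m0' lam t)
    ((continuous_V hlam).mul (by have := Strained.differentiable_U.continuous; fun_prop)) ?_ (tendsto_m0_atTop hlam) ?_ ?_ y
  · simpa only [hF, mul_assoc] using key
  · refine integrable_of_norm_le_polyGauss (Continuous.aestronglyMeasurable ?_) (1 / ‖lam + I * Uinf‖) 1 0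
      (fun t => ?_)
    · exact (continuous_const.add continuous_abs).mul ((continuous_V hlam).mul (by have := Strained.differentiable_U.continuous; fun_prop)).norm
    · rw [norm_mul, Real.norm_of_nonneg (by positivity), norm_norm, pow_one]
      have := mul_le_mul_of_nonneg_left (hFn t) (by positivity : (0:ℝ) ≤ 1 + |t|)
      simpa [mul_comm, mul_left_comm, mul_assoc] using this
  · refine tendsto_zero_atTop_of_norm_le_polyGauss (1 / ‖lam + I * Uinf‖) 0 0 (fun t => ?_)
    rw [norm_div, norm_mul, Complex.norm_I, one_mul, Complex.norm_real, Real.norm_of_nonneg (Real.exp_pos _).le]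
    simp only [pow_zero, zero_mul, Real.exp_zero, one_mul, mul_one]
    calc Real.exp (-(t ^ 2) / 2) / ‖lam + I * Uinf‖ ≤ Real.exp (-(t ^ 2) / 4) / ‖lam + I * Uinf‖ :=
          div_le_div_of_nonneg_right (Real.exp_le_exp.2 (by nlinarith [sq_nonneg t])) hDpos.le
      _ = _ := by ring
  · refine tendsto_zero_atTop_of_norm_le_polyGauss (1 / ‖lam + I * Uinf‖) 1 0 (fun t => ?_)
    rw [norm_mul, norm_div, norm_mul, Complex.norm_I, one_mul, Complex.norm_real, Complex.norm_real,
      Real.norm_of_nonneg (Real.exp_pos _).le, Real.norm_eq_abs]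
    simp only [pow_one, zero_mul, Real.exp_zero, mul_one]
    have e : Real.exp (-(t ^ 2) / 2) = Real.exp (-(t ^ 2) / 4) * Real.exp (-(t ^ 2) / 4) := by
      rw [← Real.exp_add]; congr 1; ring
    have h1 := MarginalStabilityChainBurgersLayerLowRe.abs_mul_exp_quarter_le_one t
    have h2 : |t| * Real.exp (-(t ^ 2) / 2) ≤ (1 + |t|) * Real.exp (-(t ^ 2) / 4) := by
      rw [e, ← mul_assoc]
      nlinarith [Real.exp_pos (-(t ^ 2) / 4), abs_nonneg t]
    calc |t| * (Real.exp (-(t ^ 2) / 2) / ‖lam + I * Uinf‖) = |t| * Real.exp (-(t ^ 2) / 2) / ‖lam + I * Uinf‖ := by ring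
      _ ≤ (1 + |t|) * Real.exp (-(t ^ 2) / 4) / ‖lam + I * Uinf‖ := by gcongr
      _ = _ := by ring

/-- `∫ U' m₀ = 2λU₊/(λ + iU₊)` (the primitive `(λU + iU²/2)/(λ + iU₊)` between `∓U₊`). [folklore] -/
theorem integral_gauss_mul_m0 {lam : ℂ} (hlam : 0 < lam.re) :
    ∫ t, (Real.exp (-(t ^ 2) / 2) : ℂ) * ((lam + I * (U t : ℂ)) / (lam + I * Uinf)) =
      2 * lam * Uinf / (lam + I * Uinf) := by
  have hD : lam + I * Uinf ≠ 0 := add_I_mul_ne_zero hlam Uinf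
  have hDpos : 0 < ‖lam + I * Uinf‖ := norm_pos_iff.2 hD
  set g : ℝ → ℂ := fun t => (lam * (U t : ℂ) + I * ((U t : ℂ) * (U t : ℂ)) / 2) / (lam + I * Uinf) with hg
  have hgd : ∀ t, HasDerivAt g ((Real.exp (-(t ^ 2) / 2) : ℂ) * ((lam + I * (U t : ℂ)) / (lam + I * Uinf))) t := by
    intro t
    have hU := (Strained.hasDerivAt_U t).ofReal_comp
    have := ((hU.const_mul lam).fun_add (((hU.fun_mul hU).const_mul I).div_const 2)).div_const (lam + I * Uinf)
    simp only [hg]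
    refine this.congr_deriv ?_
    ring
  have hint : Integrable fun t => (Real.exp (-(t ^ 2) / 2) : ℂ) * ((lam + I * (U t : ℂ)) / (lam + I * Uinf)) := by
    refine integrable_of_norm_le_polyGauss (Continuous.aestronglyMeasurable ?_) ((‖lam‖ + 1) / lam.re) 1 0
      (fun t => ?_)
    · have := Strained.differentiable_U.continuous; fun_prop
    · rw [norm_mul, Complex.norm_real, Real.norm_of_nonneg (Real.exp_pos _).le]
      simp only [pow_one, zero_mul, Real.exp_zero, mul_one]
      have h1 := norm_m0_le hlam t
      have h2 : Real.exp (-(t ^ 2) / 2) ≤ Real.exp (-(t ^ 2) / 4) := Real.exp_le_exp.2 (by nlinarith [sq_nonneg t])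
      have h3 : 0 ≤ (‖lam‖ + 1) / lam.re * (1 + |t|) := by positivity
      calc Real.exp (-(t ^ 2) / 2) * ‖(lam + I * (U t : ℂ)) / (lam + I * Uinf)‖
          ≤ Real.exp (-(t ^ 2) / 4) * ((‖lam‖ + 1) / lam.re * (1 + |t|)) := by gcongr
        _ = _ := by ring
  have htop : Tendsto g atTop (𝓝 ((lam * Uinf + I * ((Uinf : ℂ) * (Uinf : ℂ)) / 2) / (lam + I * Uinf))) := by
    have hU : Tendsto (fun t : ℝ => (U t : ℂ)) atTop (𝓝 (Uinf : ℂ)) := (continuous_ofReal.tendsto _).comp tendsto_U_atTop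
    simp only [hg]
    exact ((hU.const_mul lam).add (((hU.mul hU).const_mul I).div_const 2)).div_const _
  have hbot : Tendsto g atBot (𝓝 ((lam * ((-Uinf : ℝ) : ℂ) + I * (((-Uinf : ℝ) : ℂ) * ((-Uinf : ℝ) : ℂ)) / 2) / (lam + I * Uinf))) := by
    have hU : Tendsto (fun t : ℝ => (U t : ℂ)) atBot (𝓝 ((-Uinf : ℝ) : ℂ)) := (continuous_ofReal.tendsto _).comp tendsto_U_atBot
    simp only [hg]
    exact ((hU.const_mul lam).add (((hU.mul hU).const_mul I).div_const 2)).div_const _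
  rw [integral_of_hasDerivAt_of_tendsto hgd hint hbot htop, ← sub_div]
  push_cast
  congr 1
  ring

/-! ## B1. A slow mode at `h = 0`: `m = e^{αy} ψ` solves `m'' = 2α m' + V m`, `e^{αy} ω = -V m` -/

/-- The weight `e^{αy}` (as a complex number) and its derivative. [folklore] -/
theorem hasDerivAt_expWeight (α y : ℝ) :
    HasDerivAt (fun y : ℝ => (Real.exp (α * y) : ℂ)) ((α : ℂ) * (Real.exp (α * y) : ℂ)) y := by
  have h1 : HasDerivAt (fun s : ℝ => Real.exp (α * s)) (Real.exp (α * y) * α) y := by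
    simpa using ((hasDerivAt_id y).const_mul α).exp
  have := h1.ofReal_comp
  convert this using 1
  push_cast; ring

/-- From `IsSlowMode α 0 λ ψ`: with `m = e^{αy}ψ`, `m' = e^{αy}(αψ + ψ')`, `V = iU''/(λ + iU)` one has
`m' = (m)'`, `(m')' = 2α m' + V m` and `e^{αy} ω = -V m`. [folklore] -/
theorem slowMode_ode {α : ℝ} {lam : ℂ} (hlam : 0 < lam.re) {ψ : ℝ → ℂ} (hψ : IsSlowMode α 0 lam ψ) :
    (∀ y, HasDerivAt (fun y => (Real.exp (α * y) : ℂ) * ψ y)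
        ((Real.exp (α * y) : ℂ) * (α * ψ y + deriv ψ y)) y) ∧
    (∀ y, HasDerivAt (fun y => (Real.exp (α * y) : ℂ) * (α * ψ y + deriv ψ y))
        (2 * α * ((Real.exp (α * y) : ℂ) * (α * ψ y + deriv ψ y)) +
          (I * Upp y / (lam + I * U y)) * ((Real.exp (α * y) : ℂ) * ψ y)) y) ∧
    (∀ y, (Real.exp (α * y) : ℂ) * vort α ψ y =
        -((I * Upp y / (lam + I * U y)) * ((Real.exp (α * y) : ℂ) * ψ y))) := by
  obtain ⟨h4, heq, -, -, -⟩ := hψ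
  have hd : Differentiable ℝ ψ := h4.differentiable (by norm_num)
  have hd1 : Differentiable ℝ (deriv ψ) := by
    have := h4.differentiable_iteratedDeriv 1 (by norm_num)
    simpa [iteratedDeriv_one] using this
  have key : ∀ y, deriv (deriv ψ) y = ((α : ℂ) ^ 2 + I * Upp y / (lam + I * U y)) * ψ y := by
    intro y
    have hne := add_I_mul_ne_zero hlam (U y)
    have h := heq y
    simp only [Complex.ofReal_zero, zero_mul, sub_zero] at h
    rw [vort, iteratedDeriv_succ, iteratedDeriv_one] at h
    field_simp
    linear_combination -h
  have hvort : ∀ y, vort α ψ y = -(I * Upp y / (lam + I * U y) * ψ y) := by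
    intro y
    rw [vort, iteratedDeriv_succ, iteratedDeriv_one, key y]
    ring
  refine ⟨fun y => ?_, fun y => ?_, fun y => ?_⟩
  · exact ((hasDerivAt_expWeight α y).fun_mul (hd y).hasDerivAt).congr_deriv (by ring)
  · have h1 := (hasDerivAt_expWeight α y).fun_mul
      ((((hd y).hasDerivAt).const_mul (α : ℂ)).fun_add (hd1 y).hasDerivAt)
    refine h1.congr_deriv ?_
    rw [key y]
    ring
  · rw [hvort y]
    ring

/-- Part-B summary (registered sub-goal): the Volterra form of the zeroth-order Jost function,
`m₀ = 1 + K₀[V m₀]` for `re λ > 0`. [folklore] -/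
theorem sheetLimit_partB : ∀ lam : ℂ, 0 < lam.re → ∀ y : ℝ, (lam + I * (U y : ℂ)) / (lam + I * Uinf) = 1 + ∫ t in Ioi y, (volterraKernel 0 (t - y) : ℂ) * (I * (Upp t : ℂ) / (lam + I * (U t : ℂ))) * ((lam + I * (U t : ℂ)) / (lam + I * Uinf)) :=
  fun _ hlam y => m0_volterra hlam y

end Summit.AnomalousDissipation.AnomalousDissipation.Theorems.BurgersLayerKH.Sheet.SheetLimit

end
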